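import Literature.Probability.LatticeModels.CriticalBlockMoments
import Literature.Probability.LatticeModels.CriticalAxisRatioRegularity
import Literature.Probability.LatticeModels.PointwiseScalingLimitEtaExists
import HarnessLib

/-!
# Axial pincer, scalar core (crux `NonSeparableModulus`, item stmt-CriticalPhenomena-6152, line `AxialPincer`)

Routes `MonotoneBlocking` / `MirrorHoelderCompactness`, sub-problem `CriticalPhenomena/Ising3DConformalLimit`.
Helper file 1/2 of the lead's landing of the crux-ideate evidence `AxialPincer.lean`
(`NonSeparableModulus ⟹ TwoPointDoubling`, items 6152 ⟹ 6150); no definitions, no notation, no named-fact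
hypotheses, no `sorry`. Below `g(k) = ⟨σ₀σ_{k e₀}⟩_{β_c(3)} = criticalTwoPoint 3 (Pi.single 0 k)` is the critical
axis profile of the n.n. Ising model on `ℤ³`.

CONTENT.
* §1 (pure real sequences `g : ℕ → ℝ`, hypotheses: positivity and monotonicity of the one-step ratios
  `k ↦ g(k+1)/g(k)` on `k ≥ 1`): forward propagation `(g(n+1)/g(n))^m · g(n) ≤ g(n+m)` (`ratio_forward`), backward
  propagation `g(a+m) ≤ (g(n+1)/g(n))^m · g(a)` for `a + m ≤ n` (`ratio_backward`), and the pincer's scalar jaw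
  `eight_mul_le_of_ratio_lt`: a doubling defect `g(2n) < κ g(n)` with `κ ≤ 8^{-p}`, `n ≤ pJ`, forces `8 g(n) ≤ g(n − J)`.
* §2 the critical axis profile has these properties (tree theorems: Simon–Lieb positivity `criticalTwoPoint_axis_pos`,
  Messager–Miracle-Solé antitonicity `criticalTwoPoint_axis_antitone`, reflection-positivity log-convexity
  `criticalTwoPoint_axis_ratio_mono`), whence `eight_mul_axis_le_of_ratio_lt`.
* §3 two four-point sandwiches at collinear axis configurations from the tree form of Aizenman–Duminil-Copin (3.12),
  `|U₄| ≤ 2·(pairing)` (`abs_criticalUrsellFour_le_two_mul_pair01/02`), and axis antitonicity: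
  `⟨σ_0 σ_{n} σ_{2n} σ_{4n}⟩ ≤ 4 g(n) g(2n) + g(2n)²` (`four_point_mid_le`) and
  `⟨σ_0 σ_{a} σ_{2n} σ_{4n}⟩ ≥ g(a) g(2n) − g(2n)²` for `a ≤ n` (`four_point_retreat_ge`).

References: M. Aizenman, H. Duminil-Copin, Ann. of Math. 194 (2021), arXiv:1912.07973, eq. (3.12) and
§5 (Prop. 5.3, proof of Prop. 5.9, Remark 5.10) [AizenmanDuminilCopinAnnals2021]; A. Messager,
S. Miracle-Solé, J. Stat. Phys. 17 (1977) [MessagerMiracleSoleJSP1977]. Adapted from the crux workfile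
`Cruxes/NonSeparableModulus/AxialPincer.lean` (planner-cruxidea-stmt-CriticalPhenomena-6152-2-0).
-/

noncomputable section

namespace Summit.CriticalPhenomena.Ising3DConformalLimit.MonotoneBlockingNonSeparableModulusAxialPincer

open Literature.Probability.LatticeModels

/-! ### §1 Propagation of one-step ratios of a positive sequence with nondecreasing ratios -/

/-- Forward propagation: if `g > 0` and `k ↦ g(k+1)/g(k)` is nondecreasing on `k ≥ 1`, then
`(g(n+1)/g(n))^m · g(n) ≤ g(n+m)` for `n ≥ 1`. [folklore] -/
theorem ratio_forward {g : ℕ → ℝ} (hpos : ∀ k, 0 < g k)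
    (hmono : ∀ ⦃a b : ℕ⦄, 1 ≤ a → a ≤ b → g (a + 1) / g a ≤ g (b + 1) / g b)
    {n : ℕ} (hn : 1 ≤ n) (m : ℕ) : (g (n + 1) / g n) ^ m * g n ≤ g (n + m) := by
  induction m with
  | zero => simp
  | succ m ih =>
    have hr : g (n + 1) / g n ≤ g (n + m + 1) / g (n + m) := hmono hn (by omega)
    have hq : 0 ≤ g (n + m + 1) / g (n + m) := div_nonneg (hpos _).le (hpos _).le
    have hx : 0 ≤ (g (n + 1) / g n) ^ m * g n :=
      mul_nonneg (pow_nonneg (div_nonneg (hpos _).le (hpos _).le) m) (hpos _).le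
    rw [show n + (m + 1) = n + m + 1 by omega, pow_succ]
    calc (g (n + 1) / g n) ^ m * (g (n + 1) / g n) * g n
        = (g (n + 1) / g n) * ((g (n + 1) / g n) ^ m * g n) := by ring
      _ ≤ (g (n + m + 1) / g (n + m)) * g (n + m) := mul_le_mul hr ih hx hq
      _ = g (n + m + 1) := div_mul_cancel₀ _ (hpos (n + m)).ne'

/-- Backward propagation: if `g > 0` and `k ↦ g(k+1)/g(k)` is nondecreasing on `k ≥ 1`, then
`g(a+m) ≤ (g(n+1)/g(n))^m · g(a)` whenever `1 ≤ a` and `a + m ≤ n`. [folklore] -/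
theorem ratio_backward {g : ℕ → ℝ} (hpos : ∀ k, 0 < g k)
    (hmono : ∀ ⦃a b : ℕ⦄, 1 ≤ a → a ≤ b → g (a + 1) / g a ≤ g (b + 1) / g b)
    {n a : ℕ} (ha : 1 ≤ a) (m : ℕ) (ham : a + m ≤ n) :
    g (a + m) ≤ (g (n + 1) / g n) ^ m * g a := by
  induction m with
  | zero => simp
  | succ m ih =>
    have ih' := ih (by omega)
    have hr : g (a + m + 1) / g (a + m) ≤ g (n + 1) / g n := hmono (by omega) (by omega)
    have hq : 0 ≤ g (n + 1) / g n := div_nonneg (hpos _).le (hpos _).le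
    rw [show a + (m + 1) = a + m + 1 by omega, pow_succ]
    calc g (a + m + 1) = (g (a + m + 1) / g (a + m)) * g (a + m) :=
          (div_mul_cancel₀ _ (hpos (a + m)).ne').symm
      _ ≤ (g (n + 1) / g n) * ((g (n + 1) / g n) ^ m * g a) := mul_le_mul hr ih' (hpos _).le hq
      _ = (g (n + 1) / g n) ^ m * (g (n + 1) / g n) * g a := by ring

/-- **The pincer's scalar jaw** (pure real sequences). If `g > 0` is nonincreasing on `k ≥ 1` with
nondecreasing one-step ratios there, doubling fails at scale `n` with defect `g(2n) < κ·g(n)`, `κ ≤ (1/8)^p`,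
and the retreat `J` satisfies `n ≤ p·J`, `J + 1 ≤ n`, then `8·g(n) ≤ g(n − J)`: forward propagation gives
`(g(n+1)/g(n))^n ≤ g(2n)/g(n) < κ`, so `(g(n+1)/g(n))^J ≤ 1/8`, and backward propagation gives
`g(n) ≤ (g(n+1)/g(n))^J · g(n−J)`. [cite: AizenmanDuminilCopinAnnals2021, proof of Prop. 5.9] -/
theorem eight_mul_le_of_ratio_lt {g : ℕ → ℝ} (hpos : ∀ k, 0 < g k)
    (hmono : ∀ ⦃a b : ℕ⦄, 1 ≤ a → a ≤ b → g (a + 1) / g a ≤ g (b + 1) / g b)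
    (hle : ∀ k, 1 ≤ k → g (k + 1) ≤ g k)
    {n J p : ℕ} {κ : ℝ} (hn : 1 ≤ n) (hJ : J + 1 ≤ n)
    (hpJ : n ≤ p * J) (hκ : κ ≤ (1 / 8 : ℝ) ^ p) (hlt : g (2 * n) < κ * g n) :
    8 * g n ≤ g (n - J) := by
  set ρ := g (n + 1) / g n with hρ
  have hρpos : 0 < ρ := div_pos (hpos _) (hpos _)
  have hρ1 : ρ ≤ 1 := (div_le_one (hpos n)).2 (hle n hn)
  -- forward: ρ^n g(n) ≤ g(2n)
  have hf : ρ ^ n * g n ≤ g (2 * n) := by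
    have := ratio_forward hpos hmono hn n
    rwa [show n + n = 2 * n by ring] at this
  have hρn : ρ ^ n < κ := lt_of_mul_lt_mul_right (lt_of_le_of_lt hf hlt) (hpos n).le
  -- hence ρ^J ≤ 1/8
  have hρJ : ρ ^ J ≤ 1 / 8 := by
    by_contra hcon
    push Not at hcon
    have hp : p ≠ 0 := by
      rintro rfl
      simp at hpJ
      omega
    have h1 : (1 / 8 : ℝ) ^ p < (ρ ^ J) ^ p := pow_lt_pow_left₀ hcon (by norm_num) hp
    have h2 : (ρ ^ J) ^ p ≤ ρ ^ n := by
      rw [← pow_mul]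
      exact pow_le_pow_of_le_one hρpos.le hρ1 (by rw [mul_comm]; exact hpJ)
    linarith
  -- backward: g(n) ≤ ρ^J g(n - J)
  have hb : g n ≤ ρ ^ J * g (n - J) := by
    have := ratio_backward hpos hmono (n := n) (a := n - J) (by omega) J (by omega)
    rwa [show n - J + J = n by omega] at this
  have h8 := mul_le_mul_of_nonneg_right hρJ (hpos (n - J)).le
  linarith

/-! ### §2 The critical axis profile of `ℤ³` -/

/-- `g(k) ≤ 1`. [folklore] -/
theorem axis_le_one (k : ℕ) : criticalTwoPoint 3 (Pi.single 0 (k : ℤ)) ≤ 1 := criticalTwoPoint_le_one' _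

/-- Reflection-positivity log-convexity along the axis, re-indexed: for `1 ≤ a ≤ b`,
`g(a+1)/g(a) ≤ g(b+1)/g(b)`. [cite: AizenmanDuminilCopinAnnals2021, Prop. 5.3 / proof of Prop. 5.9] -/
theorem axis_ratio_mono ⦃a b : ℕ⦄ (ha : 1 ≤ a) (hab : a ≤ b) :
    criticalTwoPoint 3 (Pi.single 0 ((a + 1 : ℕ) : ℤ)) / criticalTwoPoint 3 (Pi.single 0 (a : ℤ)) ≤
      criticalTwoPoint 3 (Pi.single 0 ((b + 1 : ℕ) : ℤ)) / criticalTwoPoint 3 (Pi.single 0 (b : ℤ)) := by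
  obtain ⟨a', rfl⟩ : ∃ a', a = a' + 1 := ⟨a - 1, by omega⟩
  obtain ⟨b', rfl⟩ : ∃ b', b = b' + 1 := ⟨b - 1, by omega⟩
  exact criticalTwoPoint_axis_ratio_mono 0 (show a' ≤ b' by omega)

/-- One axis step does not increase `g` from `k ≥ 1` on. [cite: MessagerMiracleSoleJSP1977, main theorem] -/
theorem axis_succ_le (k : ℕ) (_hk : 1 ≤ k) :
    criticalTwoPoint 3 (Pi.single 0 ((k + 1 : ℕ) : ℤ)) ≤ criticalTwoPoint 3 (Pi.single 0 (k : ℤ)) :=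
  criticalTwoPoint_axis_antitone (Nat.le_succ k)

/-- **The scalar jaw for the critical axis profile**: a doubling defect `g(2n) < κ g(n)` with `κ ≤ 8^{-p}` and
a retreat `J` with `n ≤ pJ`, `J + 1 ≤ n` force `8 g(n) ≤ g(n − J)`.
[cite: AizenmanDuminilCopinAnnals2021, proof of Prop. 5.9] -/
theorem eight_mul_axis_le_of_ratio_lt {n J p : ℕ} {κ : ℝ} (hn : 1 ≤ n) (hJ : J + 1 ≤ n)
    (hpJ : n ≤ p * J) (hκ : κ ≤ (1 / 8 : ℝ) ^ p)
    (hlt : criticalTwoPoint 3 (Pi.single 0 ((2 * n : ℕ) : ℤ)) < κ * criticalTwoPoint 3 (Pi.single 0 (n : ℤ))) :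
    8 * criticalTwoPoint 3 (Pi.single 0 (n : ℤ)) ≤ criticalTwoPoint 3 (Pi.single 0 ((n - J : ℕ) : ℤ)) :=
  eight_mul_le_of_ratio_lt (g := fun k : ℕ => criticalTwoPoint 3 (Pi.single 0 (k : ℤ)))
    criticalTwoPoint_axis_pos axis_ratio_mono axis_succ_le hn hJ hpJ hκ hlt

/-! ### §3 Four-point bounds at the two collinear axis configurations -/

/-- `b e₀ − a e₀ = (b − a) e₀` for `a ≤ b`. [folklore] -/
theorem axisSite_sub {a b : ℕ} (h : a ≤ b) :
    (Pi.single 0 (b : ℤ) : Site 3) - Pi.single 0 (a : ℤ) = Pi.single 0 ((b - a : ℕ) : ℤ) := by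
  rw [← Pi.single_sub, Nat.cast_sub h]

/-- `⟨σ_{a e₀} σ_{b e₀}⟩ = g(b − a)` for `a ≤ b`. [folklore] -/
theorem corr_two_axis {a b : ℕ} (h : a ≤ b) :
    criticalCorr 3 2 ![Pi.single 0 (a : ℤ), Pi.single 0 (b : ℤ)] =
      criticalTwoPoint 3 (Pi.single 0 ((b - a : ℕ) : ℤ)) := by
  rw [criticalCorr_two_pair, axisSite_sub h]

/-- Upper bound at the caged midpoint configuration `(0, n, 2n, 4n)·e₀`:
`⟨σσσσ⟩ ≤ 4 g(n) g(2n) + g(2n)²` (Aizenman–Duminil-Copin (3.12) for the pairing `{0,n}{2n,4n}`, then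
axis monotonicity `g(3n), g(4n) ≤ g(2n)`). [cite: AizenmanDuminilCopinAnnals2021, eq. (3.12)] -/
theorem four_point_mid_le {n : ℕ} (hn : 1 ≤ n) :
    criticalCorr 3 4 ![Pi.single 0 ((0 : ℕ) : ℤ), Pi.single 0 (n : ℤ), Pi.single 0 ((2 * n : ℕ) : ℤ),
        Pi.single 0 ((4 * n : ℕ) : ℤ)] ≤
      4 * criticalTwoPoint 3 (Pi.single 0 (n : ℤ)) * criticalTwoPoint 3 (Pi.single 0 ((2 * n : ℕ) : ℤ)) +
        criticalTwoPoint 3 (Pi.single 0 ((2 * n : ℕ) : ℤ)) ^ 2 := by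
  have h := abs_criticalUrsellFour_le_two_mul_pair01 (d := 3) le_rfl (Pi.single 0 ((0 : ℕ) : ℤ))
    (Pi.single 0 (n : ℤ)) (Pi.single 0 ((2 * n : ℕ) : ℤ)) (Pi.single 0 ((4 * n : ℕ) : ℤ))
  rw [corr_two_axis (Nat.zero_le n), corr_two_axis (show 2 * n ≤ 4 * n by omega),
    corr_two_axis (Nat.zero_le (2 * n)), corr_two_axis (show n ≤ 4 * n by omega),
    corr_two_axis (Nat.zero_le (4 * n)), corr_two_axis (show n ≤ 2 * n by omega), Nat.sub_zero, Nat.sub_zero,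
    Nat.sub_zero, show 4 * n - 2 * n = 2 * n by omega, show 4 * n - n = 3 * n by omega,
    show 2 * n - n = n by omega] at h
  have h1 := (abs_le.1 h).2
  have h3 : criticalTwoPoint 3 (Pi.single 0 ((3 * n : ℕ) : ℤ)) ≤ criticalTwoPoint 3 (Pi.single 0 ((2 * n : ℕ) : ℤ)) :=
    criticalTwoPoint_axis_antitone (by omega)
  have h4 : criticalTwoPoint 3 (Pi.single 0 ((4 * n : ℕ) : ℤ)) ≤ criticalTwoPoint 3 (Pi.single 0 ((2 * n : ℕ) : ℤ)) :=
    criticalTwoPoint_axis_antitone (by omega)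
  have hg2 := (criticalTwoPoint_axis_pos (2 * n)).le
  have hgn := (criticalTwoPoint_axis_pos n).le
  nlinarith [mul_le_mul_of_nonneg_left h3 hg2, mul_le_mul_of_nonneg_left h4 hgn]

/-- Lower bound at the retreated configuration `(0, a, 2n, 4n)·e₀`, `a ≤ n`:
`⟨σσσσ⟩ ≥ g(a) g(2n) − g(2n)²` (Aizenman–Duminil-Copin (3.12) for the pairing `{0,2n}{a,4n}`,
Griffiths positivity of the dropped pairing, axis monotonicity `g(4n − a) ≤ g(2n)`).
[cite: AizenmanDuminilCopinAnnals2021, eq. (3.12)] -/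
theorem four_point_retreat_ge {n a : ℕ} (hn : 1 ≤ n) (ha : a ≤ n) :
    criticalTwoPoint 3 (Pi.single 0 (a : ℤ)) * criticalTwoPoint 3 (Pi.single 0 ((2 * n : ℕ) : ℤ)) -
        criticalTwoPoint 3 (Pi.single 0 ((2 * n : ℕ) : ℤ)) ^ 2 ≤
      criticalCorr 3 4 ![Pi.single 0 ((0 : ℕ) : ℤ), Pi.single 0 (a : ℤ), Pi.single 0 ((2 * n : ℕ) : ℤ),
        Pi.single 0 ((4 * n : ℕ) : ℤ)] := by
  have h := abs_criticalUrsellFour_le_two_mul_pair02 (d := 3) le_rfl (Pi.single 0 ((0 : ℕ) : ℤ))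
    (Pi.single 0 (a : ℤ)) (Pi.single 0 ((2 * n : ℕ) : ℤ)) (Pi.single 0 ((4 * n : ℕ) : ℤ))
  rw [corr_two_axis (Nat.zero_le a), corr_two_axis (show 2 * n ≤ 4 * n by omega),
    corr_two_axis (Nat.zero_le (2 * n)), corr_two_axis (show a ≤ 4 * n by omega),
    corr_two_axis (Nat.zero_le (4 * n)), corr_two_axis (show a ≤ 2 * n by omega), Nat.sub_zero, Nat.sub_zero,
    Nat.sub_zero, show 4 * n - 2 * n = 2 * n by omega] at h
  have h1 := (abs_le.1 h).1
  have h4 : criticalTwoPoint 3 (Pi.single 0 ((4 * n - a : ℕ) : ℤ)) ≤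
      criticalTwoPoint 3 (Pi.single 0 ((2 * n : ℕ) : ℤ)) := criticalTwoPoint_axis_antitone (by omega)
  have hg2 := (criticalTwoPoint_axis_pos (2 * n)).le
  have hprod : 0 ≤ criticalTwoPoint 3 (Pi.single 0 ((4 * n : ℕ) : ℤ)) *
      criticalTwoPoint 3 (Pi.single 0 ((2 * n - a : ℕ) : ℤ)) := mul_nonneg (criticalTwoPoint_axis_pos _).le (criticalTwoPoint_axis_pos _).le
  nlinarith [mul_le_mul_of_nonneg_left h4 hg2]

/-! ### Registered summary (helper stub of crux stmt-CriticalPhenomena-6152, line `AxialPincer`) -/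

/-- **The scalar jaw, binders explicit** (registered helper `axialPincer_scalarJaw` of crux
stmt-CriticalPhenomena-6152): a doubling defect `g(2n) < κ g(n)` with `κ ≤ 8^{-p}` and a retreat `J` with `n ≤ pJ`,
`J + 1 ≤ n` force `8 g(n) ≤ g(n − J)`. [cite: AizenmanDuminilCopinAnnals2021, proof of Prop. 5.9] -/
theorem axialPincer_scalarJaw : ∀ (n J p : ℕ) (κ : ℝ), 1 ≤ n → J + 1 ≤ n → n ≤ p * J → κ ≤ (1 / 8 : ℝ) ^ p → Literature.Probability.LatticeModels.criticalTwoPoint 3 (Pi.single 0 ((2 * n : ℕ) : ℤ)) < κ * Literature.Probability.LatticeModels.criticalTwoPoint 3 (Pi.single 0 (n : ℤ)) → 8 * Literature.Probability.LatticeModels.criticalTwoPoint 3 (Pi.single 0 (n : ℤ)) ≤ Literature.Probability.LatticeModels.criticalTwoPoint 3 (Pi.single 0 ((n - J : ℕ) : ℤ)) :=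
  fun _ _ _ _ hn hJ hpJ hκ hlt => eight_mul_axis_le_of_ratio_lt hn hJ hpJ hκ hlt

end Summit.CriticalPhenomena.Ising3DConformalLimit.MonotoneBlockingNonSeparableModulusAxialPincer

end
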